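import Mathlib
import Summits.SmoothPoincare4.SmoothPoincare4.Theorems.SoloBlindGenericState

/-!
# Tropical skeleton of the cofactor systole conjecture COF (solo-blind s7)

`paper/cs-gompf-classes.md` §4d R26 (solo seat `solo-SmoothPoincare4-blind`).  For a child state `J' = J_G` of
`J = (c, d)` the colon lattice contains the principal module `(K/d)·O` of the COFACTOR `K` (`K·G = N(G) + f_t·L`,
kernel-landed in `SoloBlindCofactor`), and CONJECTURE COF says that the cusp systole of `J'` is attained at one
of the three unit multiples `θ(θ-1)K/d`, `θ²(θ-1)K/d`, `θ(θ-1)²K/d`.  Writing an element in Minkowski coordinates of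
sizes `t^{b₁}, t^{b₂}, t^{b₃}` (for the unit `±θ^i (θ-1)^j` times `K/d`: `b = (i+j, -j, -i)`), the three cusp
functionals `lead`, `ev₀`, `ev₁` have orders (in units of `log t`)
`max(b₁-2, b₂+1, b₃+1)`, `max(b₁-3, b₂+1, b₃+2)`, `max(b₁-3, b₂+2, b₃+1)`, and the cusp product has order their sum
`L(b)`.  This file certifies the two combinatorial facts that carry the unit-orbit case of COF:

1. `tropical_lower_bound`: `L(b) ≥ 2 + (b₁ + b₂ + b₃)` for all real `b` (so non-units, whose norm has order
   `b₁+b₂+b₃ ≥ 1`, sit at order `≥ 3`);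
2. `unit_orbit_min` / `unit_orbit_gap`: on the unit lattice `b = (i+j, -j, -i)` the order is `2` EXACTLY at
   `(i,j) ∈ {(1,1), (2,1), (1,2)}` — the exponents of `θ(θ-1)`, `θ²(θ-1)`, `θ(θ-1)²` — and `≥ 4` at every other unit
   (there is no unit of order 3): away from the three cofactor vectors the cusp product of a unit multiple of `K/d`
   is larger by a factor `t^{≥ 2}` up to constants depending on the direction (measured: `10^{6.2} … 10^{12}` at
   `t = 4255`).
3. `cof_plane_relation`: `θ(θ-1) - θ²(θ-1) + θ(θ-1)² = 0`, so the three cofactor vectors span a PLANE, and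
   `cof_plane_cubic`: on that plane the cusp product of `e·v₁ + e'·v₂` is the binary cubic
   `(e' a₂ - e e₀)(e p₁ - e' e₀)((e + e') q₁ - e' e₀)` once `v₁ = (-e₀, p₁, q₁)`, `v₂ = (a₂, -e₀, q₁ - e₀)`
   (coordinatewise product of the combination; pure algebra).
Only these elementary facts are claimed; the analytic constants of R26 live in the paper.
-/

namespace Summit.SmoothPoincare4.SmoothPoincare4.Theorems

/-- Tropical order of the cusp product of an element with Minkowski sizes `t^{b₁}, t^{b₂}, t^{b₃}` times `K/d`. -/
def tropL (b₁ b₂ b₃ : ℝ) : ℝ :=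
  max (max (b₁ - 2) (b₂ + 1)) (b₃ + 1) + max (max (b₁ - 3) (b₂ + 1)) (b₃ + 2) +
    max (max (b₁ - 3) (b₂ + 2)) (b₃ + 1)

/-- Integer version on the unit lattice. -/
def tropLz (b₁ b₂ b₃ : ℤ) : ℤ :=
  max (max (b₁ - 2) (b₂ + 1)) (b₃ + 1) + max (max (b₁ - 3) (b₂ + 1)) (b₃ + 2) +
    max (max (b₁ - 3) (b₂ + 2)) (b₃ + 1)

/-- TROPICAL LEMMA: the cusp-product order is at least `2 +` the norm order. -/
theorem tropical_lower_bound (b₁ b₂ b₃ : ℝ) : 2 + (b₁ + b₂ + b₃) ≤ tropL b₁ b₂ b₃ := by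
  unfold tropL
  have h1 : b₁ - 2 ≤ max (max (b₁ - 2) (b₂ + 1)) (b₃ + 1) :=
    le_trans (le_max_left _ _) (le_max_left _ _)
  have h2 : b₃ + 2 ≤ max (max (b₁ - 3) (b₂ + 1)) (b₃ + 2) := le_max_right _ _
  have h3 : b₂ + 2 ≤ max (max (b₁ - 3) (b₂ + 2)) (b₃ + 1) :=
    le_trans (le_max_right _ _) (le_max_left _ _)
  linarith

/-- The same bound on the integer lattice. -/
theorem tropical_lower_bound_int (b₁ b₂ b₃ : ℤ) : 2 + (b₁ + b₂ + b₃) ≤ tropLz b₁ b₂ b₃ := by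
  unfold tropLz
  simp only [max_def]
  split_ifs <;> omega

/-- UNIT ORBIT: order `2` exactly at the three cofactor units `θ(θ-1)`, `θ²(θ-1)`, `θ(θ-1)²`. -/
theorem unit_orbit_min (i j : ℤ) :
    tropLz (i + j) (-j) (-i) = 2 ↔ (i = 1 ∧ j = 1) ∨ (i = 2 ∧ j = 1) ∨ (i = 1 ∧ j = 2) := by
  unfold tropLz
  simp only [max_def]
  constructor
  · intro h
    split_ifs at h <;> omega
  · intro h
    split_ifs <;> omega

/-- UNIT ORBIT GAP: every other unit has order at least `4` (no unit of order `3`). -/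
theorem unit_orbit_gap (i j : ℤ) :
    tropLz (i + j) (-j) (-i) = 2 ∨ 4 ≤ tropLz (i + j) (-j) (-i) := by
  unfold tropLz
  simp only [max_def]
  split_ifs <;> omega

section Plane
variable {R : Type*} [CommRing R]

/-- The three cofactor units are linearly dependent: `θ(θ-1) - θ²(θ-1) + θ(θ-1)² = 0`. -/
theorem cof_plane_relation (x : R) : x * (x - 1) - x ^ 2 * (x - 1) + x * (x - 1) ^ 2 = 0 := by
  ring

/-- The cusp product on the cofactor plane is an explicitly factored binary cubic: with
`v₁ = (-e₀, p₁, q₁)` and `v₂ = (a₂, -e₀, q₁ - e₀)` the coordinatewise product of `e·v₁ + e'·v₂` is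
`(e' a₂ - e e₀)(e p₁ - e' e₀)((e + e') q₁ - e' e₀)`. -/
theorem cof_plane_cubic (e e' e₀ p₁ q₁ a₂ : R) :
    (e * (-e₀) + e' * a₂) * (e * p₁ + e' * (-e₀)) * (e * q₁ + e' * (q₁ - e₀)) =
      (e' * a₂ - e * e₀) * (e * p₁ - e' * e₀) * ((e + e') * q₁ - e' * e₀) := by
  ring

/-- On the three rays `e' = 0`, `e = 0`, `e + e' = 0` the cubic is a cube times a cofactor product. -/
theorem cof_plane_rays (e e' e₀ p₁ q₁ a₂ : R) :
    (0 * a₂ - e * e₀) * (e * p₁ - 0 * e₀) * ((e + 0) * q₁ - 0 * e₀) = e ^ 3 * ((-e₀) * p₁ * q₁) ∧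
    (e' * a₂ - 0 * e₀) * (0 * p₁ - e' * e₀) * ((0 + e') * q₁ - e' * e₀) = e' ^ 3 * (a₂ * (-e₀) * (q₁ - e₀)) ∧
    (e' * a₂ - (-e') * e₀) * ((-e') * p₁ - e' * e₀) * (((-e') + e') * q₁ - e' * e₀) =
      e' ^ 3 * ((a₂ + e₀) * (p₁ + e₀) * e₀) := by
  refine ⟨by ring, by ring, by ring⟩

end Plane

end Summit.SmoothPoincare4.SmoothPoincare4.Theorems
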